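import Literature.Algebra.Homology.ExtOfAcyclicResolution
import Mathlib.CategoryTheory.Adjunction.Additive
import Mathlib.Algebra.Homology.DerivedCategory.Ext.EnoughInjectives
import HarnessLib

/-!
# `Ext` along an adjunction with exact adjoints: `Extⁿ(L A, B) ≅ Extⁿ(A, R B)` (Eckmann–Shapiro)

Topic `Algebra/Homology`; namespace `Literature.Algebra.Homology.ExtAdjunction`.  Pure homological
algebra for Mathlib's derived-category `Abelian.Ext`; no named fact, no `sorry`.

Let `L : C ⥤ D ⊣ R : D ⥤ C` be an adjunction between abelian categories, `L` additive and
preserving monomorphisms, `R` exact (preserves finite limits and colimits), `D` with enough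
injectives.  Then for all `A : C`, `B : D`, `n : ℕ`:

  `extAddEquiv adj A B n : Extⁿ_D(L A, B) ≃+ Extⁿ_C(A, R B)`.

This is the Eckmann–Shapiro lemma in its adjunction form (Weibel, *An introduction to homological
algebra*, Lemma 6.3.2 (Shapiro's Lemma) for `Res ⊣ CoInd`, Proposition 2.6.3 (`Hom ⊣ ⊗`);
Cartan–Eilenberg X §7; in the Galois setting: Serre, *Cohomologie galoisienne* I §2.5 Prop. 10, and
for `Ext`: Harari Remark 16.13, `Ext_G^i(A, I_G^H(B)) ≃ Ext_H^i(A, B)`).  Proof by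
dimension shifting on `B` (no resolutions of `A` needed): `R` maps injectives to injectives
(Mathlib `Adjunction.map_injective`, since `L` preserves monomorphisms) and carries an injective
presentation `0 → B → J → Q → 0` to a short exact sequence with injective middle term; degree `0` is
the adjunction `Hom(L A, B) ≃ Hom(A, R B)`; degree `1` is the induced isomorphism of cokernels
`Hom(L A, Q)/Hom(L A, J) ≅ Hom(A, R Q)/Hom(A, R J)` (file `ExtOfAcyclicResolution`,
`extOneQuotientAddEquiv`); degree `n + 2` is `Ext^{n+2}(L A, B) ≅ Ext^{n+1}(L A, Q) ≅ Ext^{n+1}(A, R Q)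
≅ Ext^{n+2}(A, R B)` (`shiftAddEquiv` twice and induction, for all `B` at once).

Written for Route A of the Poitou–Tate programme of crux `stmt-BirchSwinnertonDyer-19295` (cell
`bsd-schneider-ideate`, seat door-c4 gen 13): instantiated with the adjunctions `forget ⊣ CoInd`
(`DiscreteRepCoinduced.forgetCoindAdjunction`) and, later, `Res_U^Γ ⊣ CoInd_U^Γ` between the categories
of discrete modules of an open subgroup, it is Shapiro's lemma for `Ext` in `C_Γ`
(Harari Remark 16.13), the dimension-shifting input of Tate's duality theorem 16.21.

## What is here
* `extAddEquivZero` (degree `0` = the adjunction), `extAddEquivOne` (degree `1`),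
  `extAddEquivAux` (the recursion) and **`extAddEquiv adj A B n : Ext (L.obj A) B n ≃+ Ext A (R.obj B) n`**.
* `ext_map_eq_zero_of_injective` (`Ext^{q+1}(A, R J) = 0` for `J` injective).

Not here: naturality in `A` / `B` and compatibility with Yoneda composition (to be added on the
pattern of `ExtOfAcyclicResolutionNaturality`).

## References
* C. A. Weibel, *An introduction to homological algebra*, CUP (1994), Lemma 6.3.2, Prop. 2.6.3. [Weibel1994]
* D. Harari, *Galois Cohomology and Class Field Theory* (2020), Remark 16.13, Theorem 16.21. [Harari2020]
-/

-- CITATION-FIX (2026-08-27, door-c4 g13; referee flag Q-g50-1 and note N-g50-2, held copies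
-- `book:harari2017-galois-cohomology-class-field-theory`, `book:weibel1994-introduction-homological-algebra`):
-- (1) "Harari Prop. 16.17 'Shapiro for Ext'" (quoted gloss, wrong number) → Remark 16.13 (p. 269),
-- un-quoted; Prop. 16.17 (p. 272) is the cup-product/`Ext`-pairing compatibility.  (2) Weibel
-- "Ex. 2.6.3" (sheaves on a point) → Prop. 2.6.3 (`Hom ⊣ ⊗`, p. 49).  (3) Cartan–Eilenberg "XV §7"
-- → X §7 (subalgebras and subgroups).  (4) N-g50-2 (iii)/(iv) (the `R.Additive` instance, two unused
-- private lemmas) are code, left untouched by this comment-only revision.  Declarations unchanged.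

noncomputable section

universe w w' v v' u u'

namespace Literature.Algebra.Homology

namespace ExtAdjunction

open CategoryTheory CategoryTheory.Limits CategoryTheory.Abelian AcyclicResolution

variable {C : Type u} [Category.{v} C] [Abelian C] [HasExt.{w} C]
  {D : Type u'} [Category.{v'} D] [Abelian D] [HasExt.{w'} D] [EnoughInjectives D]
  {L : C ⥤ D} {R : D ⥤ C} [L.Additive] [L.PreservesMonomorphisms]
  [PreservesFiniteLimits R] [PreservesFiniteColimits R]

/-- Unfolding of Mathlib's `Ext.postcomp`. [folklore] -/
private theorem postcomp_apply'' {X Y Z : C} {n a b : ℕ} (β : Ext Y Z n) (h : a + n = b)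
    (x : Ext X Y a) : β.postcomp X h x = x.comp β h := rfl

omit [EnoughInjectives D] in
/-- Unfolding of Mathlib's `Ext.postcomp` (in `D`). [folklore] -/
private theorem postcomp_apply''' {X Y Z : D} {n a b : ℕ} (β : Ext Y Z n) (h : a + n = b)
    (x : Ext X Y a) : β.postcomp X h x = x.comp β h := rfl

/-- `R` is additive (a functor preserving finite biproducts). [cite: Weibel1994, Lemma 6.3.2] -/
instance : R.Additive := Functor.additive_of_preserves_binary_products R

omit [Abelian D] [HasExt D] [EnoughInjectives D] [L.Additive] [PreservesFiniteLimits R]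
  [PreservesFiniteColimits R] in
/-- **`Ext^{q+1}(A, R J) = 0` for `J` injective**: `R J` is injective because `L` preserves
monomorphisms (Mathlib `Adjunction.map_injective`). [cite: Weibel1994, Lemma 6.3.2] -/
theorem ext_map_eq_zero_of_injective (adj : L ⊣ R) (A : C) (J : D) [Injective J] (q : ℕ)
    (e : Ext A (R.obj J) (q + 1)) : e = 0 :=
  haveI : Injective (R.obj J) := adj.map_injective J inferInstance
  e.eq_zero_of_injective

/-- Degree `0`: `Ext⁰(L A, B) ≃+ Ext⁰(A, R B)` is the adjunction. [cite: Weibel1994, Lemma 6.3.2] -/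
def extAddEquivZero (adj : L ⊣ R) (A : C) (B : D) : Ext (L.obj A) B 0 ≃+ Ext A (R.obj B) 0 :=
  (Ext.addEquiv₀.trans (adj.homAddEquiv A B)).trans Ext.addEquiv₀.symm

omit [EnoughInjectives D] [L.PreservesMonomorphisms] [PreservesFiniteLimits R]
  [PreservesFiniteColimits R] in
/-- Formula: `extAddEquivZero adj A B (mk₀ f) = mk₀ (adj.homEquiv f)`. [cite: Weibel1994, Lemma 6.3.2] -/
@[simp]
theorem extAddEquivZero_mk₀ (adj : L ⊣ R) (A : C) (B : D) (f : L.obj A ⟶ B) :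
    extAddEquivZero adj A B (Ext.mk₀ f) = Ext.mk₀ (adj.homEquiv A B f) := by
  have h : Ext.addEquiv₀ (Ext.mk₀ f) = f := by
    rw [← Ext.addEquiv₀_symm_apply, AddEquiv.apply_symm_apply]
  change Ext.addEquiv₀.symm (adj.homAddEquiv A B (Ext.addEquiv₀ (Ext.mk₀ f))) = _
  rw [h, Adjunction.homAddEquiv_apply, Ext.addEquiv₀_symm_apply]

omit [EnoughInjectives D] [L.PreservesMonomorphisms] [PreservesFiniteLimits R]
  [PreservesFiniteColimits R] in
/-- Naturality of the degree-`0` isomorphism in `B`. [cite: Weibel1994, Lemma 6.3.2] -/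
theorem extAddEquivZero_comp_mk₀ (adj : L ⊣ R) (A : C) {B B' : D} (g : B ⟶ B') (x : Ext (L.obj A) B 0) :
    extAddEquivZero adj A B' (x.comp (Ext.mk₀ g) (add_zero 0)) =
      (extAddEquivZero adj A B x).comp (Ext.mk₀ (R.map g)) (add_zero 0) := by
  obtain ⟨f, rfl⟩ : ∃ f, x = Ext.mk₀ f := ⟨Ext.addEquiv₀ x, (Ext.mk₀_addEquiv₀_apply x).symm⟩
  rw [Ext.mk₀_comp_mk₀, extAddEquivZero_mk₀, extAddEquivZero_mk₀, Ext.mk₀_comp_mk₀,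
    adj.homEquiv_naturality_right]

/-- The injective presentation `0 → B → J(B) → Q(B) → 0` used for the dimension shift.
[cite: Weibel1994, Lemma 6.3.2] -/
abbrev presentation (B : D) : ShortComplex D :=
  ShortComplex.mk (Injective.ι B) (cokernel.π (Injective.ι B)) (cokernel.condition _)

omit [HasExt D] in
/-- It is short exact. [cite: Weibel1994, Lemma 6.3.2] -/
theorem presentation_shortExact (B : D) : (presentation B).ShortExact :=
  { exact := ShortComplex.exact_cokernel (Injective.ι B) }

omit [HasExt C] [HasExt D] [L.Additive] [L.PreservesMonomorphisms] in
/-- Its image under the exact functor `R` is short exact. [cite: Weibel1994, Lemma 6.3.2] -/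
theorem presentation_map_shortExact (B : D) :
    (ShortComplex.mk (R.map (presentation B).f) (R.map (presentation B).g)
      (by rw [← R.map_comp, (presentation B).zero, R.map_zero])).ShortExact :=
  (presentation_shortExact B).map_of_exact R

/-- Degree `1`: `Ext¹(L A, B) ≃+ Ext¹(A, R B)`, the isomorphism of cokernels
`Ext⁰(L A, Q)/Im Ext⁰(L A, J) ≅ Ext⁰(A, R Q)/Im Ext⁰(A, R J)`. [cite: Weibel1994, Lemma 6.3.2] -/
def extAddEquivOne (adj : L ⊣ R) (A : C) (B : D) : Ext (L.obj A) B 1 ≃+ Ext A (R.obj B) 1 :=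
  (extOneQuotientAddEquiv (L.obj A) (presentation_shortExact B)
      (fun e => e.eq_zero_of_injective)).trans <|
    (QuotientAddGroup.congr _ _ (extAddEquivZero adj A (cokernel (Injective.ι B))) (by
        rw [AddMonoidHom.map_range]
        apply le_antisymm
        · rintro _ ⟨x, rfl⟩
          refine ⟨extAddEquivZero adj A _ x, ?_⟩
          change (extAddEquivZero adj A _ x).comp (Ext.mk₀ (R.map (presentation B).g)) (add_zero 0) =
            extAddEquivZero adj A _ (x.comp (Ext.mk₀ (presentation B).g) (add_zero 0))
          rw [extAddEquivZero_comp_mk₀]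
        · rintro _ ⟨y, rfl⟩
          refine ⟨(extAddEquivZero adj A _).symm y, ?_⟩
          change extAddEquivZero adj A _ (((extAddEquivZero adj A _).symm y).comp
            (Ext.mk₀ (presentation B).g) (add_zero 0)) =
            y.comp (Ext.mk₀ (R.map (presentation B).g)) (add_zero 0)
          rw [extAddEquivZero_comp_mk₀, AddEquiv.apply_symm_apply])).trans
      (extOneQuotientAddEquiv A (presentation_map_shortExact B)
        (ext_map_eq_zero_of_injective adj A _ 0)).symm

/-- The recursion: `Extⁿ(L A, B) ≃+ Extⁿ(A, R B)` for all `B`, by induction on `n` (degrees `0`, `1`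
explicit; `n + 2` through `Q(B)`). [cite: Weibel1994, Lemma 6.3.2] -/
def extAddEquivAux (adj : L ⊣ R) (A : C) : (n : ℕ) → (B : D) → (Ext (L.obj A) B n ≃+ Ext A (R.obj B) n)
  | 0, B => extAddEquivZero adj A B
  | 1, B => extAddEquivOne adj A B
  | n + 2, B =>
    ((shiftAddEquiv (L.obj A) (presentation_shortExact B) (rfl : n + 1 + 1 = n + 2)
        (fun e => e.eq_zero_of_injective) (fun e => e.eq_zero_of_injective)).symm.trans
      (extAddEquivAux adj A (n + 1) (cokernel (Injective.ι B)))).trans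
      (shiftAddEquiv A (presentation_map_shortExact B) (rfl : n + 1 + 1 = n + 2)
        (ext_map_eq_zero_of_injective adj A _ n) (ext_map_eq_zero_of_injective adj A _ (n + 1)))

/-- **Eckmann–Shapiro for `Ext` along an adjunction with exact adjoints:
`Extⁿ(L A, B) ≃+ Extⁿ(A, R B)`** (`L ⊣ R`, `L` additive preserving monomorphisms, `R` exact, `D` with
enough injectives). [cite: Weibel1994, Lemma 6.3.2][cite: Harari2020, Remark 16.13] -/
def extAddEquiv (adj : L ⊣ R) (A : C) (B : D) (n : ℕ) : Ext (L.obj A) B n ≃+ Ext A (R.obj B) n :=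
  extAddEquivAux adj A n B

/-- In degree `0` it is the adjunction on `mk₀`. [cite: Weibel1994, Lemma 6.3.2] -/
@[simp]
theorem extAddEquiv_zero_mk₀ (adj : L ⊣ R) (A : C) (B : D) (f : L.obj A ⟶ B) :
    extAddEquiv adj A B 0 (Ext.mk₀ f) = Ext.mk₀ (adj.homEquiv A B f) :=
  extAddEquivZero_mk₀ adj A B f

end ExtAdjunction

end Literature.Algebra.Homology
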